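import Mathlib
import HarnessLib
import Summits.ValiantsHypothesis.ValiantsHypothesis.Theorems.LacunarySymmetroidMatrixDescartesOsculationLawRankOneCurve
import Summits.ValiantsHypothesis.ValiantsHypothesis.Theorems.LacunarySymmetroidMatrixDescartesOsculationLawTwoKRankOne

/-!
# ValiantsHypothesis / LacunarySymmetroid — crux `MatrixDescartes` (stmt-ValiantsHypothesis-18050, V1),
# line `Cruxes/MatrixDescartes/Lines/definite_pair_fold_law.lean` («definite-pair-fold-law»): the FOLD CURVE at `m = 2`

The line's law `FoldLaw : ∃ C, ∀ m K, FoldLawAt m K (2^(C (K + log₂² m)))` budgets the fold set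
`{x > 0, y > 0, Φ = 0, θ_x Φ = 0}` of the spectral curve `Φ(x,y) = det(A(x) − y·C(x))` of a definite pair.  At
`m = 2` the curve is a QUADRATIC in `y` with a positive leading coefficient: `Φ = a(x)·y² + m(x)·y + δ(x)`,
`a = det C > 0` on `x > 0`.  This file treats such a curve for ARBITRARY `a m δ : ℝ[X]`:

* `eval_Psi`, `eval_euler0_Psi` (θ-calculus for `Ψ = X₁X₁·ι a + X₁·ι m + ι δ`, `ι : X ↦ X₀`): on the curve the fold
  condition is the second quadratic `θa·y² + θm·y + θδ = 0` (`θ = X·d/dX`);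
* `bezout` (one `ring`): `U·(a y² + m y + δ) + V·(a₁ y² + m₁ y + δ₁) = Res`, the resultant of two quadratics
  `Res = (aδ₁ − δa₁)² − (am₁ − ma₁)(mδ₁ − δm₁)`, so every fold abscissa is a root of the polynomial
  `N = Res(a, m, δ, θa, θm, θδ)`;
* `prod_formula` (one `linear_combination`): with `s² = m² − 4aδ`, the product of the second quadratic over the two
  roots `(−m ± s)/(2a)` of the first is `16a²·Res`, so if `N ≡ 0` EVERY abscissa `x > 0` carries a fold point —
  excluded by finiteness (no continuity argument needed);
* `fold_curve_ncard_le` (**main**): `a > 0` on `(0,∞)`, `m² ≥ 4aδ` on `(0,∞)` and no root `y ≤ 0` over `(0,∞)`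
  imply: a finite fold set has at most `2·|supp N|` points (two ordinates per root abscissa).

`…FoldLawTwoK` instantiates this with the `2 × 2` definite pencil pair and bounds `|supp N| ≤ K⁸`.  Honest framing:
a located rung of an UNREGISTERED (critic-gated) V1 law line; `FoldLaw`, `MorseInequality` (`stub_morse`),
`stub_generic`, `MatrixDescartes`, Conjecture B and `VP ≠ VNP` are OPEN / NOT proved and nothing here is progress on
them.  No definitions, no named facts; Mathlib only.
-/

-- `Summit.ValiantsHypothesis.ValiantsHypothesis.…` is the tree's mandated single-conjunct layout (Sub = Summit).
set_option linter.dupNamespace false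

noncomputable section

namespace Summit.ValiantsHypothesis.ValiantsHypothesis.Theorems.LacunarySymmetroidMatrixDescartes

open Polynomial Set
open scoped BigOperators

namespace FoldCurve

/-! ### θ-calculus for `Ψ = X₁X₁·ι a + X₁·ι m + ι δ` -/

/-- `Ψ(t,y) = a(t)·y² + m(t)·y + δ(t)`. [folklore] -/
theorem eval_Psi (a m δ : ℝ[X]) (p : Fin 2 → ℝ) :
    MvPolynomial.eval p (MvPolynomial.X 1 * MvPolynomial.X 1 * Polynomial.aeval (MvPolynomial.X 0 : MvPolynomial (Fin 2) ℝ) a + MvPolynomial.X 1 * Polynomial.aeval (MvPolynomial.X 0 : MvPolynomial (Fin 2) ℝ) m + Polynomial.aeval (MvPolynomial.X 0 : MvPolynomial (Fin 2) ℝ) δ) = a.eval (p 0) * p 1 ^ 2 + m.eval (p 0) * p 1 + δ.eval (p 0) := by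
  simp only [map_add, map_mul, MvPolynomial.eval_X, OsculationRankOne.eval_aevalX0]
  ring

/-- `θ_x Ψ (t,y) = (θa)(t)·y² + (θm)(t)·y + (θδ)(t)`, `(θh)(t) = t·h'(t)`. [folklore] -/
theorem eval_euler0_Psi (a m δ : ℝ[X]) (Ψ : MvPolynomial (Fin 2) ℝ) (hΨ : Ψ = (MvPolynomial.X 1 * MvPolynomial.X 1 * Polynomial.aeval (MvPolynomial.X 0 : MvPolynomial (Fin 2) ℝ) a + MvPolynomial.X 1 * Polynomial.aeval (MvPolynomial.X 0 : MvPolynomial (Fin 2) ℝ) m + Polynomial.aeval (MvPolynomial.X 0 : MvPolynomial (Fin 2) ℝ) δ)) (p : Fin 2 → ℝ) :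
    MvPolynomial.eval p (MvPolynomial.X 0 * MvPolynomial.pderiv 0 Ψ) =
      (p 0 * (derivative a).eval (p 0)) * p 1 ^ 2 + (p 0 * (derivative m).eval (p 0)) * p 1
        + p 0 * (derivative δ).eval (p 0) := by
  subst hΨ
  simp only [map_add, map_mul, MvPolynomial.pderiv_mul,
    MvPolynomial.pderiv_X_of_ne (show (1 : Fin 2) ≠ 0 by decide),
    OsculationRankOne.pderiv_zero_aevalX0, MvPolynomial.eval_X, OsculationRankOne.eval_aevalX0,
    mul_zero, zero_mul, zero_add, add_zero]
  ring

/-! ### The resultant of two quadratics -/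

/-- **Bezout identity** for two quadratics: `U·f + V·g = Res(f,g)`. [folklore] -/
theorem bezout (y a m d a₁ m₁ d₁ : ℝ) :
    (y * a * a₁ * m₁ - y * m * a₁ ^ 2 - a * a₁ * d₁ + a * m₁ ^ 2 - m * a₁ * m₁ + d * a₁ ^ 2) * (a * y ^ 2 + m * y + d)
      + (-(y * a ^ 2 * m₁) + y * a * m * a₁ + a ^ 2 * d₁ - a * m * m₁ - a * d * a₁ + m ^ 2 * a₁) * (a₁ * y ^ 2 + m₁ * y + d₁) =
      a ^ 2 * d₁ ^ 2 - a * m * m₁ * d₁ - 2 * a * d * a₁ * d₁ + a * d * m₁ ^ 2 + m ^ 2 * a₁ * d₁ - m * d * a₁ * m₁ + d ^ 2 * a₁ ^ 2 := by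
  ring

/-- **Product formula**: over the two roots `(−m ± s)/(2a)` of `a y² + m y + d` (`s² = m² − 4ad`), the product of
the values `4a²·g` of the second quadratic is `16a²·Res`. [folklore] -/
theorem prod_formula (a m d a₁ m₁ d₁ s : ℝ) (hs : s * s = m ^ 2 - 4 * a * d) :
    (a₁ * (-m + 1 * s) ^ 2 + m₁ * (-m + 1 * s) * (2 * a) + d₁ * (2 * a) ^ 2)
        * (a₁ * (-m + (-1) * s) ^ 2 + m₁ * (-m + (-1) * s) * (2 * a) + d₁ * (2 * a) ^ 2) =
      16 * a ^ 2 * (a ^ 2 * d₁ ^ 2 - a * m * m₁ * d₁ - 2 * a * d * a₁ * d₁ + a * d * m₁ ^ 2 + m ^ 2 * a₁ * d₁ - m * d * a₁ * m₁ + d ^ 2 * a₁ ^ 2) := by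
  linear_combination (8 * a ^ 2 * a₁ * d₁ - 4 * a ^ 2 * m₁ ^ 2 + 4 * a * m * a₁ * m₁ - 4 * a * d * a₁ ^ 2 - m ^ 2 * a₁ ^ 2 + a₁ ^ 2 * s ^ 2) * hs

/-- A root of `a y² + m y + d` from `s² = m² − 4ad` (`a ≠ 0`; `ε = ±1` selects the root). [folklore] -/
theorem quad_root (a m d s ε : ℝ) (ha : a ≠ 0) (hs : s * s = m ^ 2 - 4 * a * d) (hε : ε * ε = 1) :
    a * ((-m + ε * s) / (2 * a)) ^ 2 + m * ((-m + ε * s) / (2 * a)) + d = 0 := by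
  have key : a * ((-m + ε * s) / (2 * a)) ^ 2 + m * ((-m + ε * s) / (2 * a)) + d =
      ((ε * ε) * (s * s) - (m ^ 2 - 4 * a * d)) / (4 * a) := by
    field_simp
    ring
  rw [key, hε, one_mul, hs, sub_self, zero_div]

/-- The second quadratic at the root `(−m + ε s)/(2a)`, scaled by `4a²`. [folklore] -/
theorem quad_value (a m a₁ m₁ d₁ s ε : ℝ) (ha : a ≠ 0) :
    a₁ * ((-m + ε * s) / (2 * a)) ^ 2 + m₁ * ((-m + ε * s) / (2 * a)) + d₁ =
      (a₁ * (-m + ε * s) ^ 2 + m₁ * (-m + ε * s) * (2 * a) + d₁ * (2 * a) ^ 2) / (4 * a ^ 2) := by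
  field_simp
  ring

/-- Value of the polynomial `N = Res(a, m, δ, θa, θm, θδ)` at `t`. [folklore] -/
theorem eval_N (a m δ : ℝ[X]) (t : ℝ) :
    (a ^ 2 * (X * derivative δ) ^ 2 - a * m * (X * derivative m) * (X * derivative δ) - 2 * a * δ * (X * derivative a) * (X * derivative δ) + a * δ * (X * derivative m) ^ 2 + m ^ 2 * (X * derivative a) * (X * derivative δ) - m * δ * (X * derivative a) * (X * derivative m) + δ ^ 2 * (X * derivative a) ^ 2).eval t =
      a.eval (t) ^ 2 * ((t) * (derivative δ).eval (t)) ^ 2 - a.eval (t) * m.eval (t) * ((t) * (derivative m).eval (t)) * ((t) * (derivative δ).eval (t)) - 2 * a.eval (t) * δ.eval (t) * ((t) * (derivative a).eval (t)) * ((t) * (derivative δ).eval (t)) + a.eval (t) * δ.eval (t) * ((t) * (derivative m).eval (t)) ^ 2 + m.eval (t) ^ 2 * ((t) * (derivative a).eval (t)) * ((t) * (derivative δ).eval (t)) - m.eval (t) * δ.eval (t) * ((t) * (derivative a).eval (t)) * ((t) * (derivative m).eval (t)) + δ.eval (t) ^ 2 * ((t) * (derivative a).eval (t)) ^ 2 :=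 by
  simp only [eval_add, eval_sub, eval_mul, eval_pow, eval_X, eval_ofNat]

/-! ### The fold count -/

/-- **Fold curve.**  For `Ψ = X₁X₁·ι a + X₁·ι m + ι δ` with `a > 0`, `m² ≥ 4aδ` and no root `y ≤ 0` over every
abscissa `t > 0`, a finite fold set `{t > 0, y > 0, Ψ = 0, θ_x Ψ = 0}` has at most `2·|supp N|` points. -/
theorem fold_curve_ncard_le (a m δ : ℝ[X]) (Ψ : MvPolynomial (Fin 2) ℝ) (hΨ : Ψ = (MvPolynomial.X 1 * MvPolynomial.X 1 * Polynomial.aeval (MvPolynomial.X 0 : MvPolynomial (Fin 2) ℝ) a + MvPolynomial.X 1 * Polynomial.aeval (MvPolynomial.X 0 : MvPolynomial (Fin 2) ℝ) m + Polynomial.aeval (MvPolynomial.X 0 : MvPolynomial (Fin 2) ℝ) δ))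
    (ha : ∀ t : ℝ, 0 < t → 0 < a.eval t)
    (hdisc : ∀ t : ℝ, 0 < t → 4 * a.eval t * δ.eval t ≤ m.eval t ^ 2)
    (hpos : ∀ t y : ℝ, 0 < t → y ≤ 0 → a.eval t * y ^ 2 + m.eval t * y + δ.eval t ≠ 0)
    (hfin : {p : Fin 2 → ℝ | 0 < p 0 ∧ 0 < p 1 ∧ MvPolynomial.eval p Ψ = 0 ∧
      MvPolynomial.eval p (MvPolynomial.X 0 * MvPolynomial.pderiv 0 Ψ) = 0}.Finite) :
    {p : Fin 2 → ℝ | 0 < p 0 ∧ 0 < p 1 ∧ MvPolynomial.eval p Ψ = 0 ∧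
      MvPolynomial.eval p (MvPolynomial.X 0 * MvPolynomial.pderiv 0 Ψ) = 0}.ncard ≤ 2 * (a ^ 2 * (X * derivative δ) ^ 2 - a * m * (X * derivative m) * (X * derivative δ) - 2 * a * δ * (X * derivative a) * (X * derivative δ) + a * δ * (X * derivative m) ^ 2 + m ^ 2 * (X * derivative a) * (X * derivative δ) - m * δ * (X * derivative a) * (X * derivative m) + δ ^ 2 * (X * derivative a) ^ 2).support.card := by
  classical
  set N : ℝ[X] := a ^ 2 * (X * derivative δ) ^ 2 - a * m * (X * derivative m) * (X * derivative δ) - 2 * a * δ * (X * derivative a) * (X * derivative δ) + a * δ * (X * derivative m) ^ 2 + m ^ 2 * (X * derivative a) * (X * derivative δ) - m * δ * (X * derivative a) * (X * derivative m) + δ ^ 2 * (X * derivative a) ^ 2 with hN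
  set fold := {p : Fin 2 → ℝ | 0 < p 0 ∧ 0 < p 1 ∧ MvPolynomial.eval p Ψ = 0 ∧
      MvPolynomial.eval p (MvPolynomial.X 0 * MvPolynomial.pderiv 0 Ψ) = 0} with hfold
  have mem_fold : ∀ p : Fin 2 → ℝ, p ∈ fold ↔ 0 < p 0 ∧ 0 < p 1 ∧
      a.eval (p 0) * p 1 ^ 2 + m.eval (p 0) * p 1 + δ.eval (p 0) = 0 ∧
      (p 0 * (derivative a).eval (p 0)) * p 1 ^ 2 + (p 0 * (derivative m).eval (p 0)) * p 1
        + p 0 * (derivative δ).eval (p 0) = 0 := by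
    intro p
    rw [hfold, Set.mem_setOf_eq, eval_euler0_Psi a m δ Ψ hΨ p, hΨ, eval_Psi]
  -- `N` vanishes at every fold abscissa (Bezout)
  have hNroot : ∀ p ∈ fold, N.IsRoot (p 0) := by
    intro p hp
    obtain ⟨-, -, hf, hg⟩ := (mem_fold p).1 hp
    have hb := bezout (p 1) (a.eval (p 0)) (m.eval (p 0)) (δ.eval (p 0)) (p 0 * (derivative a).eval (p 0))
      (p 0 * (derivative m).eval (p 0)) (p 0 * (derivative δ).eval (p 0))
    rw [hf, hg, mul_zero, mul_zero, zero_add] at hb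
    rw [IsRoot.def, hN, eval_N]
    exact hb.symm
  by_cases hN0 : N = 0
  · -- degenerate: every abscissa carries a fold point, contradicting finiteness
    exfalso
    have key : ∀ t : ℝ, 0 < t → ∃ y : ℝ, (![t, y] : Fin 2 → ℝ) ∈ fold := by
      intro t ht
      have hat := ha t ht
      set s := Real.sqrt (m.eval t ^ 2 - 4 * a.eval t * δ.eval t) with hs_def
      have hs : s * s = m.eval t ^ 2 - 4 * a.eval t * δ.eval t := Real.mul_self_sqrt (by linarith [hdisc t ht])
      have hprod := prod_formula (a.eval t) (m.eval t) (δ.eval t) (t * (derivative a).eval t)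
        (t * (derivative m).eval t) (t * (derivative δ).eval t) s hs
      have hRes0 : a.eval (t) ^ 2 * ((t) * (derivative δ).eval (t)) ^ 2 - a.eval (t) * m.eval (t) * ((t) * (derivative m).eval (t)) * ((t) * (derivative δ).eval (t)) - 2 * a.eval (t) * δ.eval (t) * ((t) * (derivative a).eval (t)) * ((t) * (derivative δ).eval (t)) + a.eval (t) * δ.eval (t) * ((t) * (derivative m).eval (t)) ^ 2 + m.eval (t) ^ 2 * ((t) * (derivative a).eval (t)) * ((t) * (derivative δ).eval (t)) - m.eval (t) * δ.eval (t) * ((t) * (derivative a).eval (t)) * ((t) * (derivative m).eval (t)) + δ.eval (t) ^ 2 * ((t) * (derivative a).eval (t)) ^ 2 = 0 := by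
        rw [← eval_N, ← hN, hN0, eval_zero]
      rw [hRes0, mul_zero] at hprod
      -- one of the two roots is a fold ordinate
      have hroot : ∀ ε : ℝ, ε * ε = 1 →
          a.eval t * ((-m.eval t + ε * s) / (2 * a.eval t)) ^ 2 + m.eval t * ((-m.eval t + ε * s) / (2 * a.eval t))
            + δ.eval t = 0 := fun ε hε => quad_root _ _ _ s ε hat.ne' hs hε
      have hval : ∀ ε : ℝ,
          (t * (derivative a).eval t) * ((-m.eval t + ε * s) / (2 * a.eval t)) ^ 2
            + (t * (derivative m).eval t) * ((-m.eval t + ε * s) / (2 * a.eval t)) + t * (derivative δ).eval t =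
          ((t * (derivative a).eval t) * (-m.eval t + ε * s) ^ 2
            + (t * (derivative m).eval t) * (-m.eval t + ε * s) * (2 * a.eval t)
            + (t * (derivative δ).eval t) * (2 * a.eval t) ^ 2) / (4 * a.eval t ^ 2) :=
        fun ε => quad_value _ _ _ _ _ s ε hat.ne'
      have hmk : ∀ ε : ℝ, ε * ε = 1 →
          (t * (derivative a).eval t) * (-m.eval t + ε * s) ^ 2
            + (t * (derivative m).eval t) * (-m.eval t + ε * s) * (2 * a.eval t)
            + (t * (derivative δ).eval t) * (2 * a.eval t) ^ 2 = 0 →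
          (![t, (-m.eval t + ε * s) / (2 * a.eval t)] : Fin 2 → ℝ) ∈ fold := by
        intro ε hε hG
        have hy : 0 < (-m.eval t + ε * s) / (2 * a.eval t) := by
          by_contra hle
          push Not at hle
          exact hpos t _ ht hle (hroot ε hε)
        refine (mem_fold _).2 ⟨?_, ?_, ?_, ?_⟩
        · simpa [Matrix.cons_val_zero] using ht
        · simpa [Matrix.cons_val_one] using hy
        · simp only [Matrix.cons_val_zero, Matrix.cons_val_one]; exact hroot ε hε
        · simp only [Matrix.cons_val_zero, Matrix.cons_val_one]
          rw [hval ε, hG, zero_div]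
      rcases mul_eq_zero.1 hprod with h | h
      · exact ⟨_, hmk 1 (by norm_num) h⟩
      · exact ⟨_, hmk (-1) (by norm_num) h⟩
    apply hfin.not_infinite
    set γ : ℝ → ℝ := fun t => if ht : 0 < t then Classical.choose (key t ht) else 0 with hγ
    refine Set.infinite_of_injOn_mapsTo (s := Set.Ioi (0 : ℝ)) (f := fun t : ℝ => (![t, γ t] : Fin 2 → ℝ))
      ?_ ?_ (Set.Ioi_infinite 0)
    · intro t _ t' _ htt'
      have := congr_fun htt' 0
      simpa [Matrix.cons_val_zero] using this
    · intro t ht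
      rw [Set.mem_Ioi] at ht
      have hspec := Classical.choose_spec (key t ht)
      have : γ t = Classical.choose (key t ht) := by rw [hγ]; simp only [dif_pos ht]
      show (![t, γ t] : Fin 2 → ℝ) ∈ fold
      rw [this]
      exact hspec
  · -- generic: two ordinates over each positive root of `N`
    set TN : Finset ℝ := N.roots.toFinset.filter (fun t => 0 < t) with hTN
    set quad : ℝ → ℝ[X] := fun t => C (a.eval t) * X ^ 2 + C (m.eval t) * X + C (δ.eval t) with hquad
    have hquad_ne : ∀ t, 0 < t → quad t ≠ 0 := by
      intro t ht h0
      have := Polynomial.natDegree_quadratic (a := a.eval t) (b := m.eval t) (c := δ.eval t) (ha t ht).ne'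
      rw [hquad] at h0
      simp only at h0
      rw [h0, natDegree_zero] at this
      exact absurd this (by norm_num)
    set S : Finset (Fin 2 → ℝ) :=
      TN.biUnion (fun t => ((quad t).roots.toFinset).image (fun b => (![t, b] : Fin 2 → ℝ))) with hS
    have hsub : fold ⊆ (S : Set (Fin 2 → ℝ)) := by
      intro p hp
      obtain ⟨htp, -, hf, -⟩ := (mem_fold p).1 hp
      rw [Finset.mem_coe, hS, Finset.mem_biUnion]
      refine ⟨p 0, ?_, ?_⟩
      · rw [hTN, Finset.mem_filter, Multiset.mem_toFinset, mem_roots hN0]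
        exact ⟨hNroot p hp, htp⟩
      · rw [Finset.mem_image]
        refine ⟨p 1, ?_, ?_⟩
        · rw [Multiset.mem_toFinset, mem_roots (hquad_ne _ htp), hquad, IsRoot.def]
          simp only [eval_add, eval_mul, eval_C, eval_pow, eval_X]
          linarith
        · funext i
          fin_cases i <;> rfl
    calc fold.ncard ≤ (S : Set (Fin 2 → ℝ)).ncard := Set.ncard_le_ncard hsub (Finset.finite_toSet _)
      _ = S.card := Set.ncard_coe_finset _
      _ ≤ ∑ t ∈ TN, (((quad t).roots.toFinset).image (fun b => (![t, b] : Fin 2 → ℝ))).card :=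
          Finset.card_biUnion_le
      _ ≤ ∑ t ∈ TN, 2 := by
          refine Finset.sum_le_sum fun t ht => ?_
          have htpos : 0 < t := (Finset.mem_filter.1 ht).2
          calc _ ≤ ((quad t).roots.toFinset).card := Finset.card_image_le
            _ ≤ Multiset.card (quad t).roots := Multiset.toFinset_card_le _
            _ ≤ (quad t).natDegree := Polynomial.card_roots' _
            _ = 2 := by rw [hquad]; exact Polynomial.natDegree_quadratic (ha t htpos).ne'
      _ = 2 * TN.card := by rw [Finset.sum_const, smul_eq_mul, mul_comm]
      _ ≤ 2 * N.support.card := by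
          apply Nat.mul_le_mul_left
          calc TN.card = (N.roots.filter (fun t => 0 < t)).toFinset.card := by rw [hTN, Multiset.toFinset_filter]
            _ ≤ Multiset.card (N.roots.filter (fun t => 0 < t)) := Multiset.toFinset_card_le _
            _ ≤ N.support.card := OsculationRankOne.card_roots_filter_pos_le_card_support N

end FoldCurve

end Summit.ValiantsHypothesis.ValiantsHypothesis.Theorems.LacunarySymmetroidMatrixDescartes
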